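import Summits.CriticalPhenomena.PercolationContinuityZ3.Theorems.PercNearOneGluingNoHeavyLowerTailThreePartitionCubeWalk
import Summits.CriticalPhenomena.PercolationContinuityZ3.Theorems.PercNearOneGluingNoHeavyLowerTailThreePartitionCubeDict
import Summits.CriticalPhenomena.PercolationContinuityZ3.Theorems.PercNearOneGluingNoHeavyLowerTailThreePartitionCubeLanes

/-!
# Twisted three-partition positivity (★★) = (M⁺-3) on SIX letters: soundness of the checker, VII — **every enumerated colouring that passes
# the filters is tested** (threading the batches through the walk)

Support file (cell `prim-sahi`, seat `prim-sahi-typer` gen 34; `--supports stmt-CriticalPhenomena-4575`).  Pure proofs plus bookkeeping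
definitions (the masks `cU`, `cV`, `dFOf`, … of a coloured node and `passes` are in `…CubeMasks`, their sizes in `…CubeDict`); no `sorry`,
standard axioms.  Pattern of `…SahiPair43LinkWalk` (g32) for the cube checker `ThreePartition.Cube.chunkCheck`:
* `BatchOK / InB / Good / Covers / StepOK` — a batch is a triple of lane vectors of masks `< 2^64`; a triple `(U, V, D)` is *covered* by the
  current batch when it occupies one of its lanes or is already *good* (`Good m U V D`: it occupies a lane of SOME valid batch that passed
  `packedTest` — by `packedTest_sound` (file IV) this gives `CodeRel m (prof m U V t) D` at every twist `t`, see `codeRel_of_good` in file XIII);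
* `push_spec`, `pushPair_spec`, `colourStep_some` / `colourStep_spec`, `nodeColourings_spec`, `nodeStep_spec`, `foldl_nodeStep_spec`;
* **`chunkCheck_sound`**: if `chunkCheck m sel M r = true` (`2^m ≤ 64`) then for every node of `rootList` with sorted keys and the right hash, and
  for the root when selected, every colouring `mm` passing the filters (`passes`) yields a GOOD triple `(cU, cV, dFOf)`; with `mem_rootList`
  (file VI): **`chunkCheck_sound_antichain`** — the same for every increasing antichain of codes whose least element is selected by `sel`.
What these masks MEAN (up-sets with the given co-generators, free points, `PairSat.PairCond`, symmetry) is the subject of the remaining files. [this work]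
-/

namespace Summit.CriticalPhenomena.PercolationContinuityZ3.Theorems.ThreePartition.Cube

open Finset SahiGridPattern.Pair43

/-! ### Valid batches and coverage -/

/-- `BatchOK b`: the three packed masks of `b` are lane vectors of `b.n` masks `< 2^64`. [this work] -/
def BatchOK (b : Batch) : Prop :=
  ∃ fU fV fD : ℕ → ℕ, b.pu = ofLanes b.n fU ∧ b.pv = ofLanes b.n fV ∧ b.pd = ofLanes b.n fD ∧
    ∀ i < b.n, fU i < 2 ^ 64 ∧ fV i < 2 ^ 64 ∧ fD i < 2 ^ 64

/-- `InB b U V D`: the triple occupies a lane of `b`. [this work] -/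
def InB (b : Batch) (U V D : ℕ) : Prop := ∃ i < b.n, laneOf b.pu i = U ∧ laneOf b.pv i = V ∧ laneOf b.pd i = D

/-- `Good m U V D`: the triple occupies a lane of some valid batch that passes `packedTest`. [this work] -/
def Good (m U V D : ℕ) : Prop := ∃ b : Batch, BatchOK b ∧ packedTest (mkTabs m) b = true ∧ InB b U V D

/-- `Covers m b U V D`: in a lane of `b`, or already good. [this work] -/
def Covers (m : ℕ) (b : Batch) (U V D : ℕ) : Prop := InB b U V D ∨ Good m U V D

/-- `StepOK m b b'`: `b'` is valid and covers everything `b` covers. [this work] -/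
def StepOK (m : ℕ) (b b' : Batch) : Prop := BatchOK b' ∧ ∀ U V D, Covers m b U V D → Covers m b' U V D

/-- Reflexivity. [this work] -/
theorem stepOK_refl (m : ℕ) {b : Batch} (hb : BatchOK b) : StepOK m b b := ⟨hb, fun _ _ _ h => h⟩

/-- Transitivity. [this work] -/
theorem StepOK.trans {m : ℕ} {b b' b'' : Batch} (h1 : StepOK m b b') (h2 : StepOK m b' b'') : StepOK m b b'' :=
  ⟨h2.1, fun U V D h => h2.2 U V D (h1.2 U V D h)⟩

/-- The empty batch is valid. [this work] -/
theorem batchOK_empty : BatchOK Batch.empty :=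
  ⟨fun _ => 0, fun _ => 0, fun _ => 0, by rw [Batch.empty, ofLanes_zero], by rw [Batch.empty, ofLanes_zero], by rw [Batch.empty, ofLanes_zero],
    fun i hi => absurd hi (Nat.not_lt_zero i)⟩

/-- In a valid batch passing `packedTest`, every occupied lane is good. [this work] -/
theorem good_of_inB {m : ℕ} {b : Batch} (hb : BatchOK b) (ht : packedTest (mkTabs m) b = true) {U V D : ℕ} (h : InB b U V D) :
    Good m U V D := ⟨b, hb, ht, h⟩

/-- Covered by a valid batch passing `packedTest` ⇒ good. [this work] -/
theorem good_of_covers {m : ℕ} {b : Batch} (hb : BatchOK b) (ht : packedTest (mkTabs m) b = true) {U V D : ℕ} (h : Covers m b U V D) :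
    Good m U V D := h.elim (good_of_inB hb ht) id

/-- **Appending a triple**: the batch stays valid, old lanes are kept, the new triple occupies a lane. [this work] -/
theorem push_spec {b : Batch} (hb : BatchOK b) {U V D : ℕ} (hU : U < 2 ^ 64) (hV : V < 2 ^ 64) (hD : D < 2 ^ 64) :
    BatchOK (b.push U V D) ∧ (∀ U' V' D', InB b U' V' D' → InB (b.push U V D) U' V' D') ∧ InB (b.push U V D) U V D := by
  obtain ⟨fU, fV, fD, hpu, hpv, hpd, hf⟩ := hb
  let fU' : ℕ → ℕ := fun i => if i = b.n then U else fU i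
  let fV' : ℕ → ℕ := fun i => if i = b.n then V else fV i
  let fD' : ℕ → ℕ := fun i => if i = b.n then D else fD i
  have hf' : ∀ i < b.n + 1, fU' i < 2 ^ 64 ∧ fV' i < 2 ^ 64 ∧ fD' i < 2 ^ 64 := fun i hi => by
    by_cases h : i = b.n
    · subst h; simp only [fU', fV', fD', if_pos rfl]; exact ⟨hU, hV, hD⟩
    · have hi' : i < b.n := by omega
      simp only [fU', fV', fD', if_neg h]; exact hf i hi'
  have lane_eq : ∀ (p x : ℕ) (f f' : ℕ → ℕ), p = ofLanes b.n f → (∀ i, f' i = if i = b.n then x else f i) →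
      p + (x <<< (LW * b.n)) = ofLanes (b.n + 1) f' := by
    intro p x f f' hp hf'
    rw [ofLanes_succ, hp, Nat.shiftLeft_eq]
    congr 1
    · exact ofLanes_congr fun i hi => by rw [hf' i, if_neg (Nat.ne_of_lt hi)]
    · rw [hf' b.n, if_pos rfl]
  have ePU : (b.push U V D).pu = ofLanes (b.n + 1) fU' := lane_eq _ _ fU fU' hpu fun _ => rfl
  have ePV : (b.push U V D).pv = ofLanes (b.n + 1) fV' := lane_eq _ _ fV fV' hpv fun _ => rfl
  have ePD : (b.push U V D).pd = ofLanes (b.n + 1) fD' := lane_eq _ _ fD fD' hpd fun _ => rfl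
  have hn : (b.push U V D).n = b.n + 1 := rfl
  have hL1 : ∀ i < b.n + 1, fU' i < 2 ^ LW := fun i hi => (hf' i hi).1.trans_le pow64_le_LW
  have hL2 : ∀ i < b.n + 1, fV' i < 2 ^ LW := fun i hi => (hf' i hi).2.1.trans_le pow64_le_LW
  have hL3 : ∀ i < b.n + 1, fD' i < 2 ^ LW := fun i hi => (hf' i hi).2.2.trans_le pow64_le_LW
  have o1 : ∀ i < b.n, fU i < 2 ^ LW := fun i hi => (hf i hi).1.trans_le pow64_le_LW
  have o2 : ∀ i < b.n, fV i < 2 ^ LW := fun i hi => (hf i hi).2.1.trans_le pow64_le_LW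
  have o3 : ∀ i < b.n, fD i < 2 ^ LW := fun i hi => (hf i hi).2.2.trans_le pow64_le_LW
  refine ⟨⟨fU', fV', fD', ePU, ePV, ePD, hf'⟩, fun U' V' D' ⟨i, hi, h1, h2, h3⟩ => ⟨i, by rw [hn]; omega, ?_, ?_, ?_⟩,
    ⟨b.n, by rw [hn]; omega, ?_, ?_, ?_⟩⟩
  · rw [ePU, laneOf_ofLanes hL1 (by omega)]
    rw [hpu, laneOf_ofLanes o1 hi] at h1
    simp only [fU', if_neg (Nat.ne_of_lt hi), h1]
  · rw [ePV, laneOf_ofLanes hL2 (by omega)]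
    rw [hpv, laneOf_ofLanes o2 hi] at h2
    simp only [fV', if_neg (Nat.ne_of_lt hi), h2]
  · rw [ePD, laneOf_ofLanes hL3 (by omega)]
    rw [hpd, laneOf_ofLanes o3 hi] at h3
    simp only [fD', if_neg (Nat.ne_of_lt hi), h3]
  · rw [ePU, laneOf_ofLanes hL1 (Nat.lt_succ_self _)]; simp only [fU', if_pos rfl]
  · rw [ePV, laneOf_ofLanes hL2 (Nat.lt_succ_self _)]; simp only [fV', if_pos rfl]
  · rw [ePD, laneOf_ofLanes hL3 (Nat.lt_succ_self _)]; simp only [fD', if_pos rfl]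

/-- **`pushPair`**: on success everything stays covered and the pushed triple is covered. [this work] -/
theorem pushPair_spec {m : ℕ} {b b' : Batch} (hb : BatchOK b) {U V D : ℕ} (hU : U < 2 ^ 64) (hV : V < 2 ^ 64)
    (hD : D < 2 ^ 64) (h : pushPair (mkTabs m) b U V D = some b') : StepOK m b b' ∧ Covers m b' U V D := by
  obtain ⟨hok, hkeep, hnew⟩ := push_spec hb hU hV hD
  unfold pushPair at h
  simp only [] at h
  split at h
  · cases h
    exact ⟨⟨hok, fun U' V' D' hcv => hcv.elim (fun hin => Or.inl (hkeep U' V' D' hin)) Or.inr⟩, Or.inl hnew⟩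
  · split at h
    · rename_i ht
      cases h
      exact ⟨⟨batchOK_empty, fun U' V' D' hcv => Or.inr (hcv.elim (fun hin => good_of_inB hok ht (hkeep U' V' D' hin)) id)⟩,
        Or.inr (good_of_inB hok ht hnew)⟩
    · cases h

/-! ### Colourings of a node -/

/-- **One colouring**: everything stays covered, and if the colouring passes the filters its triple is covered. [this work] -/
theorem colourStep_spec {m : ℕ} (hm : 2 ^ m ≤ 64) {pts K : Array ℕ} {cb upN dF mm : ℕ} (hdF : dF < 2 ^ 64) {b b' : Batch} (hb : BatchOK b)
    (h : colourStep (mkTabs m) pts K cb upN dF mm (some b) = some b') :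
    StepOK m b b' ∧ (passes (mkTabs m) pts K cb upN mm = true → Covers m b' (cU m pts mm) (cV m pts mm) dF) := by
  rw [colourStep_some] at h
  by_cases hp : passes (mkTabs m) pts K cb upN mm = true
  · rw [if_pos hp] at h
    obtain ⟨hs, hc⟩ := pushPair_spec hb (cU_lt hm pts mm) (cV_lt hm pts mm) hdF h
    exact ⟨hs, fun _ => hc⟩
  · rw [if_neg hp] at h
    cases h
    exact ⟨stepOK_refl m hb, fun h' => absurd h' hp⟩

/-- The fold over the colourings. [this work] -/
theorem foldBelow_colour_spec {m : ℕ} (hm : 2 ^ m ≤ 64) (pts K : Array ℕ) (cb upN dF : ℕ) (hdF : dF < 2 ^ 64) :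
    ∀ (N : ℕ) (b b' : Batch), BatchOK b → foldBelow N (colourStep (mkTabs m) pts K cb upN dF) (some b) = some b' →
      StepOK m b b' ∧ ∀ mm < N, passes (mkTabs m) pts K cb upN mm = true → Covers m b' (cU m pts mm) (cV m pts mm) dF
  | 0, b, b', hb, h => by
    simp only [foldBelow, Option.some.injEq] at h
    subst h
    exact ⟨stepOK_refl m hb, fun mm hmm => absurd hmm (Nat.not_lt_zero _)⟩
  | N + 1, b, b', hb, h => by
    rw [foldBelow] at h
    cases hN : foldBelow N (colourStep (mkTabs m) pts K cb upN dF) (some b) with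
    | none => rw [hN, colourStep_none] at h; cases h
    | some b₁ =>
      rw [hN] at h
      obtain ⟨hs1, hc1⟩ := foldBelow_colour_spec hm pts K cb upN dF hdF N b b₁ hb hN
      obtain ⟨hs2, hc2⟩ := colourStep_spec hm hdF hs1.1 h
      refine ⟨hs1.trans hs2, fun mm hmm hp => ?_⟩
      rcases Nat.lt_succ_iff_lt_or_eq.1 hmm with hmm | rfl
      · exact hs2.2 _ _ _ (hc1 mm hmm hp)
      · exact hc2 hp

/-- **All colourings of a node.** [this work] -/
theorem nodeColourings_spec {m : ℕ} (hm : 2 ^ m ≤ 64) {pts K : Array ℕ} {b b' : Batch} (hb : BatchOK b)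
    (h : nodeColourings (mkTabs m) pts K (some b) = some b') :
    StepOK m b b' ∧ ∀ mm < 1 <<< (pts.size - 1), passes (mkTabs m) pts K (cbOf m pts) (upNOf m pts) mm = true →
      Covers m b' (cU m pts mm) (cV m pts mm) (dFOf m pts) := by
  unfold nodeColourings at h
  exact foldBelow_colour_spec hm pts K (cbOf m pts) (upNOf m pts) (dFOf m pts) (dFOf_lt hm pts) _ b b' hb h

/-- `NodeCov m b pts`: every colouring of the node `pts` passing the filters (keys `fullKey`) is covered by `b`. [this work] -/
def NodeCov (m : ℕ) (b : Batch) (pts : Array ℕ) : Prop :=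
  ∀ mm < 1 <<< (pts.size - 1), passes (mkTabs m) pts (fullKey (mkTabs m) pts) (cbOf m pts) (upNOf m pts) mm = true →
    Covers m b (cU m pts mm) (cV m pts mm) (dFOf m pts)

/-- `NodeCov` is transported along `StepOK`. [this work] -/
theorem NodeCov.mono {m : ℕ} {b b' : Batch} {pts : Array ℕ} (h : NodeCov m b pts) (hs : StepOK m b b') : NodeCov m b' pts :=
  fun mm hmm hp => hs.2 _ _ _ (h mm hmm hp)

/-- **One node.** [this work] -/
theorem nodeStep_spec {m : ℕ} (hm : 2 ^ m ≤ 64) {M r : ℕ} {pts S : Array ℕ} {b b' : Batch} (hb : BatchOK b)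
    (h : nodeStep (mkTabs m) M r pts S (some b) = some b') :
    StepOK m b b' ∧ (keySorted (mkTabs m) S = true → keySorted (mkTabs m) (fullKey (mkTabs m) pts) = true → ptsHash pts % M = r →
      NodeCov m b' pts) := by
  unfold nodeStep at h
  simp only [] at h
  split_ifs at h with h1 h2
  · obtain ⟨hs, hc⟩ := nodeColourings_spec hm hb h
    exact ⟨hs, fun _ _ _ => hc⟩
  · cases h
    refine ⟨stepOK_refl m hb, fun _ hK hh => ?_⟩
    exfalso; apply h2; simp [hK, hh]
  · cases h
    exact ⟨stepOK_refl m hb, fun hS _ _ => absurd hS h1⟩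

/-- **A fold of nodes.** [this work] -/
theorem foldl_nodeStep_spec {m : ℕ} (hm : 2 ^ m ≤ 64) (M r : ℕ) : ∀ (L : List (Array ℕ × Array ℕ)) (b b' : Batch), BatchOK b →
    L.foldl (fun ob nd => nodeStep (mkTabs m) M r nd.1 nd.2 ob) (some b) = some b' →
    StepOK m b b' ∧ ∀ nd ∈ L, keySorted (mkTabs m) nd.2 = true → keySorted (mkTabs m) (fullKey (mkTabs m) nd.1) = true →
      ptsHash nd.1 % M = r → NodeCov m b' nd.1
  | [], b, b', hb, h => by
    simp only [List.foldl_nil, Option.some.injEq] at h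
    subst h
    exact ⟨stepOK_refl m hb, fun nd hnd => absurd hnd List.not_mem_nil⟩
  | nd :: L, b, b', hb, h => by
    rw [List.foldl_cons] at h
    cases h1 : nodeStep (mkTabs m) M r nd.1 nd.2 (some b) with
    | none => rw [h1, foldl_nodeStep_none] at h; cases h
    | some b₁ =>
      rw [h1] at h
      obtain ⟨hs1, hc1⟩ := nodeStep_spec hm hb h1
      obtain ⟨hs2, hc2⟩ := foldl_nodeStep_spec hm M r L b₁ b' hs1.1 h
      refine ⟨hs1.trans hs2, fun nd' hnd' => ?_⟩
      rcases List.mem_cons.1 hnd' with rfl | hmem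
      · exact fun hS hK hh => (hc1 hS hK hh).mono hs2
      · exact hc2 nd' hmem

/-! ### The chunk -/

/-- **SOUNDNESS OF `chunkCheck` (node form).**  If the chunk passes, then (i) at every node of the enumeration with sorted keys and the chunk's
hash, every colouring passing the filters gives a good triple, and (ii) so does the root (the empty antichain) when it belongs to the chunk.
[this work] -/
theorem chunkCheck_sound {m sel M r : ℕ} (hm : 2 ^ m ≤ 64) (h : chunkCheck m sel M r = true) :
    (∀ nd ∈ rootList (mkTabs m) sel (2 ^ m) 0, keySorted (mkTabs m) nd.2 = true → keySorted (mkTabs m) (fullKey (mkTabs m) nd.1) = true →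
      ptsHash nd.1 % M = r → ∀ mm < 1 <<< (nd.1.size - 1),
        passes (mkTabs m) nd.1 (fullKey (mkTabs m) nd.1) (cbOf m nd.1) (upNOf m nd.1) mm = true → Good m (cU m nd.1 mm) (cV m nd.1 mm) (dFOf m nd.1)) ∧
    ((sel.testBit 0 && (r == 0)) = true → ∀ mm < 1,
        passes (mkTabs m) #[] (Array.replicate m 0) (cbOf m #[]) (upNOf m #[]) mm = true → Good m (cU m #[] mm) (cV m #[] mm) (dFOf m #[])) := by
  unfold chunkCheck at h
  simp only [] at h
  split at h
  · exact absurd h Bool.false_ne_true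
  · rename_i b hwalk
    rw [np_eq] at hwalk
    -- the root batch
    have hroot : ∃ b0, (if (sel.testBit 0 && (r == 0)) = true then nodeColourings (mkTabs m) #[] (Array.replicate m 0) (some Batch.empty)
        else some Batch.empty) = some b0 ∧ BatchOK b0 ∧ ((sel.testBit 0 && (r == 0)) = true → ∀ mm < 1,
          passes (mkTabs m) #[] (Array.replicate m 0) (cbOf m #[]) (upNOf m #[]) mm = true →
            Covers m b0 (cU m #[] mm) (cV m #[] mm) (dFOf m #[])) := by
      by_cases hsel : (sel.testBit 0 && (r == 0)) = true
      · rw [if_pos hsel] at hwalk ⊢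
        cases h0 : nodeColourings (mkTabs m) #[] (Array.replicate m 0) (some Batch.empty) with
        | none => rw [h0, rootWalk_none] at hwalk; cases hwalk
        | some b0 =>
          obtain ⟨hs, hc⟩ := nodeColourings_spec hm batchOK_empty h0
          exact ⟨b0, rfl, hs.1, fun _ => hc⟩
      · rw [if_neg hsel] at hwalk ⊢
        exact ⟨Batch.empty, rfl, batchOK_empty, fun h' => absurd h' hsel⟩
    obtain ⟨b0, e0, hb0, hc0⟩ := hroot
    rw [e0, rootWalk_eq_foldl] at hwalk
    obtain ⟨hs, hc⟩ := foldl_nodeStep_spec hm M r _ b0 b hb0 hwalk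
    refine ⟨fun nd hnd hS hK hh mm hmm hp => good_of_covers hs.1 h (hc nd hnd hS hK hh mm hmm hp),
      fun hsel mm hmm hp => good_of_covers hs.1 h (hs.2 _ _ _ (hc0 hsel mm hmm hp))⟩

/-- **SOUNDNESS OF `chunkCheck` (antichain form).**  If the chunk passes, then for every nonempty increasing antichain of codes `q₀ :: Q'`
(codes `< 2^m`, pairwise incomparable) whose least element `q₀` is selected by `sel`, whose running keys and full keys are sorted and whose
hash is `≡ r (mod M)`, every colouring passing the filters gives a good triple. [this work] -/
theorem chunkCheck_sound_antichain {m sel M r : ℕ} (hm : 2 ^ m ≤ 64) (h : chunkCheck m sel M r = true) {q₀ : ℕ} {Q' : List ℕ}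
    (hch : (q₀ :: Q').Pairwise (· < ·)) (hlt : ∀ q ∈ q₀ :: Q', q < 2 ^ m)
    (hanti : ∀ q ∈ q₀ :: Q', ∀ q' ∈ q₀ :: Q', q ≠ q' → sub q q' = false) (hsel : sel.testBit q₀ = true)
    (hS : keySorted (mkTabs m) (keysOf (mkTabs m) (zeros (mkTabs m)) (q₀ :: Q')) = true)
    (hK : keySorted (mkTabs m) (fullKey (mkTabs m) (q₀ :: Q').toArray) = true) (hh : ptsHash (q₀ :: Q').toArray % M = r)
    {mm : ℕ} (hmm : mm < 1 <<< Q'.length)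
    (hp : passes (mkTabs m) (q₀ :: Q').toArray (fullKey (mkTabs m) (q₀ :: Q').toArray) (cbOf m (q₀ :: Q').toArray) (upNOf m (q₀ :: Q').toArray) mm
      = true) :
    Good m (cU m (q₀ :: Q').toArray mm) (cV m (q₀ :: Q').toArray mm) (dFOf m (q₀ :: Q').toArray) := by
  have hmem := mem_rootList m sel (2 ^ m) 0 q₀ Q' hch hlt hanti hsel (Nat.zero_le _) (by omega)
  rw [ptsOf_nil_eq] at hmem
  have := (chunkCheck_sound hm h).1 _ hmem hS hK hh mm (by simpa using hmm) hp
  exact this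

end Summit.CriticalPhenomena.PercolationContinuityZ3.Theorems.ThreePartition.Cube
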